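import Literature.Computability.AlgebraicComplexity.AlmanLi2026BlockFreeLunch
import Literature.Computability.AlgebraicComplexity.AlmanLi2026Bootstrap
import Literature.LinearAlgebra.Matrix.FullRankFactorization
import HarnessLib

/-!
# Thm. 6.3 of Alman–Li 2026 with GENERAL groups, by its second printed proof (rank-decomposition data)

Topic `Literature/Computability/AlgebraicComplexity` (family `MatrixMultiplication`). Source: J. Alman,
B. Li, *Asymptotic Rank Speedup Theorems, Revisited*, arXiv:2605.21738 (2026), §6, Theorem 6.3 and its
SECOND proof (held text `paper:arxiv-2605.21738`, p. 15 L104 – p. 16 L55), read first-hand.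

## The printed statement (p. 15 L104–109)

"Theorem 6.3. Let `T ⊴ ⟨r⟩`, and let `{a_i}, {b_i}, {c_i}` be `𝔽(λ)`-vectors representing the
degeneration. Suppose there exist nonzero scalars `c'_i` and a partition of `[r]` into `p` groups
`[r] = I_1 ⊔ ⋯ ⊔ I_p`. For each `1 ≤ α ≤ p`, let `r_α = |I_α|`, let `M_α = ∑_{i∈I_α} a_i b_i c'_i`, and let
`s_α ≥ Rk(M_α)`. If `r_α + s_α ≥ 2n` for all `α`, then
`T ⊕ ⊕_{α=1}^p ⟨1, r_α + s_α − 2n, 1⟩ ⊴ ⟨r⟩ ⊕ ⊕_{α=1}^p ⟨1, s_α, 1⟩`."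
Second proof (p. 16 L14–55): extend the restriction to `S = ⟨r⟩ ⊕ ⊕_α ⟨1,s_α,1⟩` through rank
factorisations of the `M_α` (Prop. 5.4 blockwise), take `C'` spanned by the functionals
`w_i ↦ c'_i w'_{α(i)}`, `w'_α ↦ −w'_α` (one per block, `(A ⊗ B ⊗ C') S = 0`), apply the free-lunch
theorem once; block `α`'s annihilator equations only involve block `α`'s variables, and the contraction
`(id ⊗ id ⊗ f_α) S = diag(c'_i)_{i∈I_α} ⊕ (−1_{s_α})` has rank `r_α + s_α`, so each block compresses to
`⟨1, r_α + s_α − n − m, 1⟩`.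

## The form proved here (any field)

* `AlmanLi2026.thm63_rankDecomposition_general` — the λ-FREE case with general, unequal groups: a rank
  decomposition `T = ∑_{i<r} a_i ⊗ b_i ⊗ c_i` (`A, B, C₀` columns, `n = |ι'|`, `m = |κ'|`), a block map
  `g : Fin r → P`, nonzero `c'`, bounds `rank M_α ≤ s_α`; conclusion
  `⟨r⟩ ⊕ ⊕_α ⟨1,s_α,1⟩ ⊵ T ⊕ ⊕_α ⟨1, r_α + s_α − (n+m), 1⟩`, both family sums being `blockSliceTensor K
  Sigma.fst` (`BlockSliceTensor.lean`; the two-group / equal-group instances by the FIRST proof are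
  `AlmanLi2026AppendDirectSum.lean`). The engine is `AlmanLi2026.freeLunch_blockFunctional`
  (`AlmanLi2026BlockFreeLunch.lean`).
* `AlmanLi2026.thm63_degeneration_of_decomposition_general` — THE PRINTED SETTING: border-rank data
  (`𝔽(λ)`-vectors `u_i, v_i, w_i` presenting `P = λ^h T + O(λ^{h+1})`, nonzero `c'_i ∈ 𝔽(λ)`,
  `rank M_α ≤ s_α` over `𝔽(λ)`), same conclusion over `K`: the λ-free theorem over the FIELD `K(λ)`
  (`RatFunc K`), the slice blocks rescaled by `λ^h`, and the Cor. 5.1 bootstrap of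
  `AlmanLi2026Bootstrap.lean` (`algDegeneratesTo_of_isFractionRing`) — the route of
  `AlmanLi2026AppendDirectSumBound.lean` for Thm. 6.1, whose two plumbing lemmas are re-proved here
  privately to keep the import chain short.

## References

* J. Alman, B. Li, arXiv:2605.21738 (2026), Thm. 6.3 and its second proof (§6, pp. 15–16); Prop. 5.4;
  Thm. 5.1. [AlmanLi2026]
-/

noncomputable section

open scoped BigOperators

namespace Literature.Computability.AlgebraicComplexity

universe u

variable {K : Type u}

namespace AlmanLi2026

/-- Contracting `S = ⟨r⟩ ⊕ ⊕_α ⟨1,s_α,1⟩` against block vectors: the diagonal of `⟨r⟩` and the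
support `w'_α ↔ (u'_{αℓ}, v'_{αℓ})` of the slices. [cite: AlmanLi2026, Thm. 6.3 (second proof: "S = ⟨r⟩ ⊕ ⊕_α ⟨1,s_α,1⟩")] -/
theorem thm63_sum_source [CommRing K] {r : ℕ} {P : Type} [Fintype P] [DecidableEq P] {s : P → ℕ}
    (F G : Fin r ⊕ (Σ α : P, Fin (s α)) → K) (H : Fin r ⊕ P → K) :
    (∑ x, ∑ y, ∑ z, F x * G y * H z *
      directSumTensor (unitTensor K r) (blockSliceTensor K (Sigma.fst : (Σ α : P, Fin (s α)) → P)) x y z) =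
      (∑ i, F (Sum.inl i) * G (Sum.inl i) * H (Sum.inl i)) +
        ∑ y : (Σ α : P, Fin (s α)), F (Sum.inr y) * G (Sum.inr y) * H (Sum.inr y.1) := by
  simp only [Fintype.sum_sum_type, directSumTensor_inl, directSumTensor_inr, directSumTensor_inl_inr,
    directSumTensor_inr_inl, directSumTensor_mixed₃_inr, directSumTensor_mixed₃_inl, mul_zero,
    Finset.sum_const_zero, add_zero, zero_add]
  congr 1
  · refine Finset.sum_congr rfl fun i _ => ?_
    rw [Finset.sum_eq_single i (fun j _ hj => by simp [Ne.symm hj]) (by simp),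
      Finset.sum_eq_single i (fun l _ hl => by simp [Ne.symm hl]) (by simp)]
    simp
  · refine Finset.sum_congr rfl fun y _ => ?_
    rw [Finset.sum_eq_single y (fun y' _ hy' => by simp [Ne.symm hy']) (by simp)]
    simp only [blockSliceTensor_apply, true_and, mul_ite, mul_one, mul_zero, Finset.sum_ite_eq,
      Finset.mem_univ, if_true]

/-- The contraction `(id ⊗ id ⊗ f_α) S` against `f_α = ∑_{i∈I_α} c'_i w_i^* − w'^*_α`:
`diag(c'_i)_{i ∈ I_α} ⊕ (−1_{s_α})`. [cite: AlmanLi2026, Thm. 6.3 (second proof, display for `(id ⊗ id ⊗ C')S`)] -/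
theorem thm63_contraction [CommRing K] {r : ℕ} {P : Type} [Fintype P] [DecidableEq P] {s : P → ℕ}
    (g : Fin r → P) (c' : Fin r → K) (α : P)
    (x y : Fin r ⊕ (Σ α : P, Fin (s α))) :
    (∑ z, Sum.elim (fun i => if g i = α then c' i else 0) (fun β => if β = α then (-1 : K) else 0) z *
      directSumTensor (unitTensor K r) (blockSliceTensor K (Sigma.fst : (Σ α : P, Fin (s α)) → P)) x y z)
      = Sum.elim (fun i => Sum.elim (fun j => if i = j ∧ g i = α then c' i else 0) (fun _ => 0) y)
          (fun x => Sum.elim (fun _ => 0) (fun y => if x = y ∧ x.1 = α then (-1 : K) else 0) y) x := by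
  rcases x with i | x <;> rcases y with j | y
  · simp only [Fintype.sum_sum_type, Sum.elim_inl, Sum.elim_inr, directSumTensor_inl,
      directSumTensor_mixed₃_inr, mul_zero, Finset.sum_const_zero, add_zero, unitTensor_apply]
    by_cases hij : i = j
    · subst hij
      rw [Finset.sum_eq_single i (fun k _ hk => by simp [Ne.symm hk]) (by simp)]
      by_cases hg : g i = α <;> simp [hg]
    · simp [hij]
  · simp
  · simp
  · simp only [Fintype.sum_sum_type, Sum.elim_inl, Sum.elim_inr, directSumTensor_inr,
      directSumTensor_mixed₃_inl, mul_zero, Finset.sum_const_zero, zero_add, blockSliceTensor_apply]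
    by_cases h : x = y
    · subst h
      simp only [true_and, mul_ite, mul_one, mul_zero]
      rw [Finset.sum_eq_single x.1 (fun b _ hb => by simp [Ne.symm hb]) (by simp)]
      by_cases hx : x.1 = α <;> simp [hx]
    · simp [h]

/-- `R M C = 1` forces `rank M ≥ |s|`. [folklore] -/
private theorem card_le_rank_of_mul_mul_eq_one' [Field K] {m n σ : Type} [Fintype m] [Fintype n]
    [Fintype σ] [DecidableEq σ] (M : Matrix m n K) (R : Matrix σ m K) (C : Matrix n σ K)
    (h : R * M * C = 1) : Fintype.card σ ≤ M.rank := by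
  have h1 : (R * M * C).rank = Fintype.card σ := by rw [h, Matrix.rank_one]
  have h2 := (Matrix.rank_mul_le_left (R * M) C).trans (Matrix.rank_mul_le_right R M)
  omega

/-- `rank (diag(c'_i)_{i∈I_α} ⊕ (−1_{s_α})) ≥ r_α + s_α` for nonzero `c'` ("which has rank `r = q + s`",
Prop. 5.4 / Thm. 6.3). [cite: AlmanLi2026, Thm. 6.3 (second proof) with Prop. 5.4] -/
theorem thm63_rank [Field K] {r : ℕ} {P : Type} [Fintype P] [DecidableEq P] {s : P → ℕ}
    (g : Fin r → P) {c' : Fin r → K} (hc' : ∀ i, c' i ≠ 0) (α : P) :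
    Fintype.card {i : Fin r // g i = α} + s α ≤
      (Matrix.of fun (x y : Fin r ⊕ (Σ α : P, Fin (s α))) =>
        Sum.elim (fun i => Sum.elim (fun j => if i = j ∧ g i = α then c' i else 0) (fun _ => 0) y)
          (fun x => Sum.elim (fun _ => 0) (fun y => if x = y ∧ x.1 = α then (-1 : K) else 0) y) x).rank := by
  classical
  have hcard : Fintype.card ({i : Fin r // g i = α} ⊕ Fin (s α)) =
      Fintype.card {i : Fin r // g i = α} + s α := by
    rw [Fintype.card_sum, Fintype.card_fin]
  rw [← hcard]
  refine card_le_rank_of_mul_mul_eq_one' _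
    (Matrix.of fun (t : {i : Fin r // g i = α} ⊕ Fin (s α)) (x : Fin r ⊕ (Σ α : P, Fin (s α))) =>
      Sum.elim (fun i => if x = Sum.inl i.1 then (c' i.1)⁻¹ else 0)
        (fun ℓ => if x = Sum.inr ⟨α, ℓ⟩ then (1 : K) else 0) t)
    (Matrix.of fun (y : Fin r ⊕ (Σ α : P, Fin (s α))) (t : {i : Fin r // g i = α} ⊕ Fin (s α)) =>
      Sum.elim (fun i => if y = Sum.inl i.1 then (1 : K) else 0)
        (fun ℓ => if y = Sum.inr ⟨α, ℓ⟩ then (-1 : K) else 0) t) ?_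
  ext t t'
  rw [Matrix.mul_apply]
  simp only [Matrix.mul_apply, Matrix.of_apply]
  rcases t with ⟨i, hi⟩ | ℓ <;> rcases t' with ⟨i', hi'⟩ | ℓ'
  · simp only [Sum.elim_inl, ite_mul, zero_mul, Finset.sum_ite_eq', Finset.mem_univ, if_true,
      mul_ite, mul_one, mul_zero, Matrix.one_apply, Sum.inl.injEq, Subtype.mk.injEq]
    by_cases h : i = i'
    · subst h; simp [hi, hc' i]
    · simp [h]
  · simp
  · simp
  · simp only [Sum.elim_inr, ite_mul, one_mul, zero_mul, Finset.sum_ite_eq', Finset.mem_univ, if_true,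
      mul_ite, mul_neg, mul_one, mul_zero, Matrix.one_apply, Sum.inr.injEq]
    by_cases h : ℓ = ℓ' <;> simp [h]

/-- **Alman–Li 2026, Thm. 6.3 with general groups (λ-free case), by the second printed proof.** For a
rank decomposition `T = ∑_{i<r} a_i ⊗ b_i ⊗ c_i` over a field (columns of `A, B, C₀`; `n = |ι'|`,
`m = |κ'|`), a block map `g : Fin r → P` (`I_α = g⁻¹(α)`, `r_α = |I_α|`), nonzero scalars `c'` and
bounds `rank (∑_{i∈I_α} c'_i a_i b_iᵀ) ≤ s_α`:
`⟨r⟩ ⊕ ⊕_α ⟨1,s_α,1⟩ ⊵ T ⊕ ⊕_α ⟨1, r_α + s_α − (n+m), 1⟩` (family sums = `blockSliceTensor K Sigma.fst`).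
Proof as printed (second proof): Prop. 5.4 blockwise (`M_α = P_α Q_αᵀ`), `C'` spanned by
`f_α = ∑_{i∈I_α} c'_i w_i^* − w'^*_α`, the block free lunch. [cite: AlmanLi2026, Thm. 6.3 (second proof)] -/
theorem thm63_rankDecomposition_general [Field K] {ι' κ' μ' : Type*} [Fintype ι'] [Fintype κ']
    [Fintype μ'] [DecidableEq ι'] [DecidableEq κ'] {r : ℕ} {P : Type} [Fintype P] [DecidableEq P]
    {T : ι' → κ' → μ' → K} {A : ι' → Fin r → K} {B : κ' → Fin r → K} {C₀ : μ' → Fin r → K}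
    (hT : ∀ a b c, T a b c = ∑ i, A a i * B b i * C₀ c i)
    (g : Fin r → P) {c' : Fin r → K} (hc' : ∀ i, c' i ≠ 0) (s : P → ℕ)
    (hM : ∀ α, (Matrix.of fun a b => ∑ i, if g i = α then A a i * B b i * c' i else 0).rank ≤ s α) :
    AlgDegeneratesTo
      (directSumTensor (unitTensor K r) (blockSliceTensor K (Sigma.fst : (Σ α : P, Fin (s α)) → P)))
      (directSumTensor T (blockSliceTensor K (Sigma.fst :
        (Σ α : P, Fin (Fintype.card {i : Fin r // g i = α} + s α -
          (Fintype.card ι' + Fintype.card κ'))) → P))) := by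
  classical
  -- Prop. 5.4 blockwise: `M_α = P_α Q_αᵀ`
  choose Pm Qm hPQ using fun α =>
    Literature.LinearAlgebra.Matrix.exists_eq_mul_transpose_of_rank_le _ (hM α)
  have hPQ' : ∀ α a b, (∑ i, if g i = α then A a i * B b i * c' i else 0) =
      ∑ ℓ, Pm α a ℓ * Qm α b ℓ := fun α a b => by
    have h := congrFun (congrFun (hPQ α) a) b
    simpa only [Matrix.of_apply, Matrix.mul_apply, Matrix.transpose_apply] using h
  have h := freeLunch_blockFunctional (K := K) (P := P)
    (S := directSumTensor (unitTensor K r)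
      (blockSliceTensor K (Sigma.fst : (Σ α : P, Fin (s α)) → P)))
    (T := T)
    (A := fun a => Sum.elim (A a) (fun y : (Σ α : P, Fin (s α)) => Pm y.1 a y.2))
    (B := fun b => Sum.elim (B b) (fun y : (Σ α : P, Fin (s α)) => Qm y.1 b y.2))
    (C₀ := fun c => Sum.elim (C₀ c) (fun _ => (0 : K)))
    ?_ (fun α => Sum.elim (fun i => if g i = α then c' i else 0) (fun β => if β = α then (-1 : K) else 0))
    ?_ (Sum.elim g Sigma.fst) (Sum.elim g Sigma.fst) ?_ ?_
  · -- shrink `rank M_α − (n+m)` to `r_α + s_α − (n+m)`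
    beta_reduce at h
    have hle : ∀ α : P, Fintype.card {i : Fin r // g i = α} + s α - (Fintype.card ι' + Fintype.card κ') ≤
        (Matrix.of fun (x y : Fin r ⊕ (Σ α : P, Fin (s α))) =>
          ∑ z, Sum.elim (fun i => if g i = α then c' i else 0) (fun β => if β = α then (-1 : K) else 0) z *
            directSumTensor (unitTensor K r)
              (blockSliceTensor K (Sigma.fst : (Σ α : P, Fin (s α)) → P)) x y z).rank -
          (Fintype.card ι' + Fintype.card κ') := by
      intro α
      have hr := thm63_rank (K := K) (s := s) g hc' α
      have hMx : (Matrix.of fun (x y : Fin r ⊕ (Σ α : P, Fin (s α))) =>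
          ∑ z, Sum.elim (fun i => if g i = α then c' i else 0) (fun β => if β = α then (-1 : K) else 0) z *
            directSumTensor (unitTensor K r)
              (blockSliceTensor K (Sigma.fst : (Σ α : P, Fin (s α)) → P)) x y z) =
          Matrix.of fun (x y : Fin r ⊕ (Σ α : P, Fin (s α))) =>
            Sum.elim (fun i => Sum.elim (fun j => if i = j ∧ g i = α then c' i else 0) (fun _ => 0) y)
              (fun x => Sum.elim (fun _ => 0) (fun y => if x = y ∧ x.1 = α then (-1 : K) else 0) y) x := by
        ext x y
        exact thm63_contraction (K := K) g c' α x y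
      rw [hMx]
      omega
    refine h.trans_restrictsTo ((TensorRestrictsTo.refl _).directSum
      (tensorRestrictsTo_blockSliceTensor_of_comp_eq (f := id)
        (e := fun x => ⟨x.1, Fin.castLE (hle x.1) x.2⟩) ?_ Function.injective_id (fun _ => rfl)))
    rintro ⟨γ, k⟩ ⟨β, l⟩ hxy
    obtain ⟨rfl, h2⟩ := Sigma.mk.inj_iff.mp hxy
    have := Fin.castLE_injective _ (eq_of_heq h2)
    subst this
    rfl
  · -- (1) the extended restriction `T = [(A P) ⊗ (B Q) ⊗ (C 0)] S`
    intro a b c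
    rw [thm63_sum_source]
    simp [hT]
  · -- (2) `f_α` kills it: `M_α − P_α Q_αᵀ = 0`
    intro α a b
    rw [thm63_sum_source]
    simp only [Sum.elim_inl, Sum.elim_inr]
    rw [Fintype.sum_sigma, Finset.sum_eq_single α (fun β _ hβ => by simp [hβ]) (by simp)]
    simp only [if_true, mul_neg, mul_one, Finset.sum_neg_distrib]
    have h1 : (∑ i, A a i * B b i * (if g i = α then c' i else 0)) =
        ∑ i, if g i = α then A a i * B b i * c' i else 0 :=
      Finset.sum_congr rfl fun i _ => by split_ifs <;> simp
    rw [h1, hPQ' α a b]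
    ring
  · -- (3) row supports
    intro α x y hx
    rw [thm63_contraction]
    rcases x with i | x <;> rcases y with j | y
    · simp only [Sum.elim_inl] at hx ⊢
      have : ¬(i = j ∧ g i = α) := fun hh => hx hh.2
      simp [this]
    · simp
    · simp
    · simp only [Sum.elim_inr] at hx ⊢
      have : ¬(x = y ∧ x.1 = α) := fun hh => hx hh.2
      simp [this]
  · -- (4) column supports
    intro α x y hy
    rw [thm63_contraction]
    rcases x with i | x <;> rcases y with j | y
    · simp only [Sum.elim_inl] at hy ⊢
      have : ¬(i = j ∧ g i = α) := fun hh => hy (by rw [← hh.1]; exact hh.2)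
      simp [this]
    · simp
    · simp
    · simp only [Sum.elim_inr] at hy ⊢
      have : ¬(x = y ∧ x.1 = α) := fun hh => hy (by rw [← hh.1]; exact hh.2)
      simp [this]

/-! ## The printed setting: border-rank data over `K(λ)` (Cor. 5.1 bootstrap) -/

section BorderRank

open Polynomial

variable {K : Type} [Field K]

/-- Rescaling a direct summand by `λ^h` is a restriction over `L ⊇ K[λ]`: `Y ⊕ Z ≥ Y ⊕ λ^h·Z` on the
images (private copy of the plumbing of `AlmanLi2026AppendDirectSumBound.lean`). [cite: AlmanLi2026, Cor. 5.1 (proof)] -/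
private theorem restrictsTo_directSum_X_pow_mul₆₃ {L : Type} [Field L] [Algebra K[X] L]
    {ι κ μ ι' κ' μ' : Type} [Fintype ι] [Fintype κ] [Fintype μ] [Fintype ι'] [Fintype κ'] [Fintype μ']
    [DecidableEq ι] [DecidableEq κ] [DecidableEq μ] [DecidableEq ι'] [DecidableEq κ'] [DecidableEq μ']
    (P : ι → κ → μ → K[X]) (Z : ι' → κ' → μ' → K) (h : ℕ) :
    TensorRestrictsTo
      (directSumTensor (fun a b c => algebraMap K[X] L (P a b c))
        (fun x y z => algebraMap K[X] L (Polynomial.C (Z x y z))))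
      (fun a b c => algebraMap K[X] L
        (directSumTensor P (fun x y z => Polynomial.X ^ h * Polynomial.C (Z x y z)) a b c)) := by
  refine ⟨fun a a' => if a' = a then 1 else 0, fun b b' => if b' = b then 1 else 0,
    fun c c' => if c' = c then Sum.elim (fun _ => (1 : L)) (fun _ => algebraMap K[X] L Polynomial.X ^ h) c
      else 0, fun a b c => ?_⟩
  rw [Finset.sum_eq_single a (fun x _ hx => by simp [hx]) (by simp),
    Finset.sum_eq_single b (fun x _ hx => by simp [hx]) (by simp),
    Finset.sum_eq_single c (fun x _ hx => by simp [hx]) (by simp)]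
  rcases a with a | a <;> rcases b with b | b <;> rcases c with c | c <;>
    simp [directSumTensor]
  exact mul_comm _ _

/-- The `λ`-adic lowest term of `P ⊕ λ^h·Z` is `T ⊕ Z` at order `h` (private copy of the plumbing of
`AlmanLi2026AppendDirectSumBound.lean`). [cite: AlmanLi2026, Cor. 5.1 (proof)] -/
private theorem coeff_directSum_X_pow_mul₆₃ {ι κ μ ι' κ' μ' : Type} (P : ι → κ → μ → K[X])
    (Z : ι' → κ' → μ' → K) {T : ι → κ → μ → K} {h : ℕ}
    (hP : ∀ a b c, ∀ j ≤ h, (P a b c).coeff j = if j = h then T a b c else 0) :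
    ∀ a b c, ∀ j ≤ h,
      (directSumTensor P (fun x y z => Polynomial.X ^ h * Polynomial.C (Z x y z)) a b c).coeff j =
        if j = h then directSumTensor T Z a b c else 0 := by
  intro a b c j hj
  rcases a with a | a <;> rcases b with b | b <;> rcases c with c | c
  · rw [directSumTensor_inl, directSumTensor_inl]
    exact hP a b c j hj
  · simp [directSumTensor]
  · simp [directSumTensor]
  · simp [directSumTensor]
  · simp [directSumTensor]
  · simp [directSumTensor]
  · simp [directSumTensor]
  · rw [directSumTensor_inr, directSumTensor_inr, Polynomial.coeff_X_pow_mul', Polynomial.coeff_C]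
    by_cases hjh : j = h
    · subst hjh
      simp
    · rw [if_neg hjh]
      split_ifs with h1 h2
      · omega
      · rfl
      · rfl

/-- The image of a block one-slice tensor over `K` is the block one-slice tensor over `L`. [folklore] -/
private theorem map_blockSlice₆₃ {L : Type} [CommRing L] [Algebra K[X] L] {τ ν : Type} [DecidableEq τ]
    [DecidableEq ν] (g : τ → ν) :
    (fun x y z => algebraMap K[X] L (Polynomial.C (blockSliceTensor K g x y z))) = blockSliceTensor L g := by
  funext x y z
  simp [blockSliceTensor_apply, apply_ite Polynomial.C, apply_ite (algebraMap K[X] L)]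

/-- `⟨r⟩ ⊕ blockSlice` over `L` is the image of the same `0/1` tensor over `K`. [folklore] -/
private theorem directSum_unit_blockSlice_eq_map₆₃ {L : Type} [CommRing L] [Algebra K[X] L]
    {τ ν : Type} [DecidableEq τ] [DecidableEq ν] (r : ℕ) (g : τ → ν) :
    directSumTensor (unitTensor L r) (blockSliceTensor L g) =
      fun a b c => algebraMap K[X] L (Polynomial.C
        (directSumTensor (unitTensor K r) (blockSliceTensor K g) a b c)) := by
  funext a b c
  rcases a with a | a <;> rcases b with b | b <;> rcases c with c | c <;>
    simp [directSumTensor, unitTensor_apply, blockSliceTensor_apply, apply_ite Polynomial.C,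
      apply_ite (algebraMap K[X] L)]

/-- **Alman–Li 2026, Thm. 6.3 AS PRINTED (border-rank data), general groups.** Let `T ⊴ ⟨r⟩` be
presented by `𝔽(λ)`-vectors: a `K[λ]`-tensor `P = λ^h T + O(λ^{h+1})` with
`P = ∑_{i<r} u_i ⊗ v_i ⊗ w_i` over `K(λ) = RatFunc K`; let `g : Fin r → P` be the partition into groups,
`c'_i ≠ 0` in `K(λ)`, and `rank (∑_{i∈I_α} c'_i u_i v_iᵀ) ≤ s_α`. Then over `K`:
`⟨r⟩ ⊕ ⊕_α ⟨1,s_α,1⟩ ⊵ T ⊕ ⊕_α ⟨1, r_α + s_α − (n+m), 1⟩` (`n = |ι'|`, `m = |κ'|`; printed for cubic `T`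
with `2n`). Proof: `thm63_rankDecomposition_general` over the field `K(λ)`, the appended blocks
rescaled by `λ^h`, Cor. 5.1 (`algDegeneratesTo_of_isFractionRing`). [cite: AlmanLi2026, Thm. 6.3] -/
theorem thm63_degeneration_of_decomposition_general {ι' κ' μ' : Type} [Fintype ι'] [Fintype κ']
    [Fintype μ'] [DecidableEq ι'] [DecidableEq κ'] [DecidableEq μ'] {r : ℕ} {P : Type} [Fintype P]
    [DecidableEq P] {T : ι' → κ' → μ' → K} {Pt : ι' → κ' → μ' → K[X]} {h : ℕ}
    (hP : ∀ a b c, ∀ j ≤ h, (Pt a b c).coeff j = if j = h then T a b c else 0)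
    {u : Fin r → ι' → RatFunc K} {v : Fin r → κ' → RatFunc K} {w : Fin r → μ' → RatFunc K}
    (hdec : ∀ a b c, algebraMap K[X] (RatFunc K) (Pt a b c) = ∑ i, u i a * v i b * w i c)
    (g : Fin r → P) {c' : Fin r → RatFunc K} (hc' : ∀ i, c' i ≠ 0) (s : P → ℕ)
    (hM : ∀ α, (Matrix.of fun a b => ∑ i, if g i = α then u i a * v i b * c' i else 0).rank ≤ s α) :
    AlgDegeneratesTo
      (directSumTensor (unitTensor K r) (blockSliceTensor K (Sigma.fst : (Σ α : P, Fin (s α)) → P)))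
      (directSumTensor T (blockSliceTensor K (Sigma.fst :
        (Σ α : P, Fin (Fintype.card {i : Fin r // g i = α} + s α -
          (Fintype.card ι' + Fintype.card κ'))) → P))) := by
  classical
  -- the λ-free theorem over the field `K(λ)`
  have hL := thm63_rankDecomposition_general (K := RatFunc K) (P := P)
    (T := fun a b c => algebraMap K[X] (RatFunc K) (Pt a b c))
    (A := fun a i => u i a) (B := fun b i => v i b) (C₀ := fun c i => w i c) hdec g hc' s hM
  -- rescale the appended blocks by `λ^h` and bootstrap
  have hscale := restrictsTo_directSum_X_pow_mul₆₃ (L := RatFunc K) Pt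
    (blockSliceTensor K (Sigma.fst : (Σ α : P, Fin (Fintype.card {i : Fin r // g i = α} + s α -
      (Fintype.card ι' + Fintype.card κ'))) → P)) h
  rw [map_blockSlice₆₃] at hscale
  have hdegL := hL.trans_restrictsTo hscale
  rw [directSum_unit_blockSlice_eq_map₆₃ (K := K)] at hdegL
  exact algDegeneratesTo_of_isFractionRing (K := K) (L := RatFunc K)
    (coeff_directSum_X_pow_mul₆₃ Pt _ hP) hdegL

end BorderRank

end AlmanLi2026

end Literature.Computability.AlgebraicComplexity
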